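import Literature.NumberTheory.GaloisRepresentations.ResidualGaloisRep
import Mathlib.RingTheory.Flat.TorsionFree
import Mathlib.RingTheory.LocalRing.Module
import Mathlib.LinearAlgebra.Charpoly.ToMatrix
import Mathlib.LinearAlgebra.Projection
import HarnessLib

/-!
# Saturation of a stable subspace in a stable lattice over a valuation ring (every rank)

Topic `Literature/NumberTheory/GaloisRepresentations`.  Theorems only (no definitions, no named
facts).  Let `O ⊆ F` be a valuation subring (no Noetherian hypothesis: e.g. the valuation ring
`ℤ̄_ℓ` of `ℚ̄_ℓ`, `padicAlgClIntegers`) and `ρ₀ : G → GL_n(O)` a homomorphism (an integral model,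
`IsIntegralModelOf`).  The general-rank form of the saturation argument done by hand in rank two
in `ResiduallyReducibleOfStableLine.lean` (Serre, *Abelian ℓ-adic representations* (1968), Ch. I
§1.1; Skinner–Wiles 1999, §4.6): *a stable subspace `W` of the generic fibre `Fⁿ` meets the
stable lattice `Λ = Oⁿ` in a saturated stable sub-lattice `Λ_W = Λ ∩ W`*; `Λ/Λ_W ↪ Fⁿ/W` is
finitely generated and torsion-free, hence free over the valuation ring `O` (Bézout + local:
Mathlib `Module.Flat.flat_iff_torsion_eq_bot_of_isBezout`, `Module.free_of_flat_of_isLocalRing`;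
Bourbaki, *Algèbre commutative* VI § 3 n° 6, Lemme 1), so `Λ = Λ_W ⊕ C` with both summands
free, and in an adapted `O`-basis `ρ₀` is block upper triangular with diagonal blocks
`A : G → GL_m(O)`, `D : G → GL_p(O)`, `m, p > 0`, `m + p = n`,
`det(X - ρ₀(g)) = det(X - A(g)) det(X - D(g))` (Mathlib `Matrix.charpoly_fromBlocks_zero₂₁`).
Consumer: `IrreducibleOfIrreducibleReduction.lean` ("`ρ̄` irreducible ⇒ `ρ` irreducible").

## Main results (all proved)

* `free_of_torsion_eq_bot_valuationSubring` — finitely generated torsion-free `O`-modules are free.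
* `exists_blocks_of_isCompl_of_basis` — dévissage along a stable free direct summand (any
  commutative coefficient ring would do; stated over `O`).
* `exists_blocks_of_subrepresentation_valuationSubring` — saturation + dévissage.

## References

* J.-P. Serre, *Abelian ℓ-adic representations and elliptic curves* (1968), Ch. I §1.1.
  [SerreAbelianLadic1968]
* N. Bourbaki, *Algèbre commutative*, Ch. VI § 3 n° 6, Lemme 1.
* C. Skinner, A. Wiles, Publ. Math. IHÉS 89 (1999), §4.6. [SkinnerWiles1999]
-/

noncomputable section

open scoped MatrixGroups
open Matrix Module IsLocalRing

namespace Literature.NumberTheory.GaloisRepresentations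

universe u v

/-! ### Saturation: dévissage of an integral model along a stable subspace of the generic fibre -/

section Saturation

variable {F : Type u} [Field F] {O : ValuationSubring F} {n : ℕ} {G : Type v} [Group G]

/-- A finitely generated torsion-free module over a valuation subring is free (Bézout + local;
Bourbaki, *Algèbre commutative* VI § 3 n° 6, Lemme 1; cf. `free_of_fg_submodule_valuationSubring`).
[folklore] -/
theorem free_of_torsion_eq_bot_valuationSubring (M : Type*) [AddCommGroup M] [Module O M]
    [Module.Finite O M] (h : Submodule.torsion O M = ⊥) : Module.Free O M := by
  haveI : Module.Flat O M := (Module.Flat.flat_iff_torsion_eq_bot_of_isBezout).mpr h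
  exact Module.free_of_flat_of_isLocalRing

/-- **Dévissage over a free decomposition (any commutative ring).**  Let `R₀` be a representation
of `G` on `Oⁿ` through `ρ₀ : G → GL_n(O)` and `Oⁿ = Λ₁ ⊕ C` a decomposition into free submodules of
ranks `m`, `p` with `Λ₁` stable.  Then the diagonal blocks of the matrices of `ρ₀` in an adapted
basis are homomorphisms `A : G → GL_m(O)`, `D : G → GL_p(O)` with
`det(X - ρ₀(g)) = det(X - A(g)) det(X - D(g))` (Mathlib `Matrix.charpoly_fromBlocks_zero₂₁`) and
`m + p = n`.  Same computation as the field case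
`Literature.RepresentationTheory.Semisimple.exists_blocks_of_subrepresentation`. [folklore] -/
theorem exists_blocks_of_isCompl_of_basis {m p : ℕ} (ρ₀ : G →* GL (Fin n) O)
    (Λ₁ C : Submodule O (Fin n → O)) (hc : IsCompl Λ₁ C) (bW : Basis (Fin m) O Λ₁)
    (bC : Basis (Fin p) O C)
    (hstab : ∀ g, ∀ v ∈ Λ₁, ((ρ₀ g : GL (Fin n) O) : Matrix (Fin n) (Fin n) O) *ᵥ v ∈ Λ₁) :
    m + p = n ∧ ∃ (A : G →* GL (Fin m) O) (D : G →* GL (Fin p) O), ∀ g,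
      ((ρ₀ g : GL (Fin n) O) : Matrix (Fin n) (Fin n) O).charpoly =
        ((A g : GL (Fin m) O) : Matrix (Fin m) (Fin m) O).charpoly *
          ((D g : GL (Fin p) O) : Matrix (Fin p) (Fin p) O).charpoly := by
  classical
  set R₀ : Representation O G (Fin n → O) := (glStdRepresentation (Fin n) O).comp ρ₀ with hR₀
  have hRapply : ∀ (g : G) (v : Fin n → O),
      R₀ g v = ((ρ₀ g : GL (Fin n) O) : Matrix (Fin n) (Fin n) O) *ᵥ v := fun _ _ ↦ rfl
  have hRlin : ∀ g, (R₀ g : (Fin n → O) →ₗ[O] (Fin n → O)) =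
      Matrix.toLin' ((ρ₀ g : GL (Fin n) O) : Matrix (Fin n) (Fin n) O) := fun g ↦
    LinearMap.ext fun v ↦ by rw [Matrix.toLin'_apply, hRapply]
  -- an adapted basis `b`
  let f : (Λ₁ × C) ≃ₗ[O] (Fin n → O) := Submodule.prodEquivOfIsCompl Λ₁ C hc
  let b : Basis (Fin m ⊕ Fin p) O (Fin n → O) := (bW.prod bC).map f
  have hmp : m + p = n := by
    simpa using (Module.finrank_eq_card_basis b).symm.trans (Module.finrank_fin_fun O)
  have hrepr : ∀ w : Fin n → O, w ∈ Λ₁ → ∀ i : Fin p, b.repr w (Sum.inr i) = 0 := by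
    intro w hw i
    have h1 : b.repr w = (bW.prod bC).repr (f.symm w) := by
      simp only [b, Module.Basis.map_repr, LinearEquiv.trans_apply]
    have h2 : f.symm w = ((⟨w, hw⟩ : Λ₁), 0) :=
      Submodule.prodEquivOfIsCompl_symm_apply_left (p := Λ₁) (q := C) hc (⟨w, hw⟩ : Λ₁)
    rw [h1, h2, Module.Basis.prod_repr_inr]
    simp
  have hb_inl : ∀ j : Fin m, (b (Sum.inl j) : Fin n → O) ∈ Λ₁ := by
    intro j
    have : b (Sum.inl j) = f ((bW.prod bC) (Sum.inl j)) := by simp [b]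
    rw [this, Submodule.coe_prodEquivOfIsCompl', Module.Basis.prod_apply_inl_fst,
      Module.Basis.prod_apply_inl_snd]
    simp
  -- matrices in the adapted basis
  let M : G → Matrix (Fin m ⊕ Fin p) (Fin m ⊕ Fin p) O := fun g ↦ LinearMap.toMatrix b b (R₀ g)
  have hM_mul : ∀ g h, M (g * h) = M g * M h := fun g h ↦ by
    simp only [M, map_mul]
    exact LinearMap.toMatrix_mul b _ _
  have hM_one : M 1 = 1 := by
    simp only [M, map_one]
    exact LinearMap.toMatrix_one b
  have hM_charpoly : ∀ g, (M g).charpoly =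
      ((ρ₀ g : GL (Fin n) O) : Matrix (Fin n) (Fin n) O).charpoly := fun g ↦ by
    simp only [M]
    rw [LinearMap.charpoly_toMatrix, hRlin, Matrix.charpoly_toLin']
  have h21 : ∀ g, (M g).toBlocks₂₁ = 0 := by
    intro g
    refine Matrix.ext fun i j ↦ ?_
    change M g (Sum.inr i) (Sum.inl j) = 0
    simp only [M, LinearMap.toMatrix_apply]
    exact hrepr _ (hstab g _ (hb_inl j)) i
  -- the diagonal blocks are multiplicative
  let A₀ : G → Matrix (Fin m) (Fin m) O := fun g ↦ (M g).toBlocks₁₁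
  let B₀ : G → Matrix (Fin m) (Fin p) O := fun g ↦ (M g).toBlocks₁₂
  let D₀ : G → Matrix (Fin p) (Fin p) O := fun g ↦ (M g).toBlocks₂₂
  have hblock : ∀ g, M g = Matrix.fromBlocks (A₀ g) (B₀ g) 0 (D₀ g) := fun g ↦ by
    conv_lhs => rw [← Matrix.fromBlocks_toBlocks (M g), h21 g]
  have hmul : ∀ g h, A₀ (g * h) = A₀ g * A₀ h ∧ D₀ (g * h) = D₀ g * D₀ h := by
    intro g h
    have e1 := hM_mul g h
    rw [hblock, hblock, hblock, Matrix.fromBlocks_multiply] at e1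
    obtain ⟨hA, -, -, hD⟩ := Matrix.fromBlocks_inj.mp e1
    refine ⟨?_, ?_⟩
    · rw [hA, Matrix.mul_zero, add_zero]
    · rw [hD, Matrix.zero_mul, zero_add]
  have hone : A₀ 1 = 1 ∧ D₀ 1 = 1 := by
    have e1 := hM_one
    rw [hblock, ← Matrix.fromBlocks_one] at e1
    obtain ⟨hA, -, -, hD⟩ := Matrix.fromBlocks_inj.mp e1
    exact ⟨hA, hD⟩
  -- as homomorphisms into `GL`
  let A : G →* GL (Fin m) O :=
    { toFun := fun g ↦ ⟨A₀ g, A₀ g⁻¹, by rw [← (hmul _ _).1, mul_inv_cancel, hone.1],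
        by rw [← (hmul _ _).1, inv_mul_cancel, hone.1]⟩
      map_one' := Units.ext hone.1
      map_mul' := fun g h ↦ Units.ext (hmul g h).1 }
  let D : G →* GL (Fin p) O :=
    { toFun := fun g ↦ ⟨D₀ g, D₀ g⁻¹, by rw [← (hmul _ _).2, mul_inv_cancel, hone.2],
        by rw [← (hmul _ _).2, inv_mul_cancel, hone.2]⟩
      map_one' := Units.ext hone.2
      map_mul' := fun g h ↦ Units.ext (hmul g h).2 }
  refine ⟨hmp, A, D, fun g ↦ ?_⟩
  rw [← hM_charpoly, hblock, Matrix.charpoly_fromBlocks_zero₂₁]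
  rfl

/-- **Saturation and dévissage over a valuation ring** (Serre, *Abelian ℓ-adic representations*
(1968), Ch. I §1.1; the general-rank form of
`exists_conjGL_apply_one_zero_eq_zero_of_hasCommonEigenvector_map`).  Let `O ⊆ F` be a
valuation subring (e.g. the non-Noetherian `ℤ̄_ℓ ⊆ ℚ̄_ℓ`), `ρ₀ : G → GL_n(O)`, and `W` a proper
non-zero subrepresentation of the generic fibre `ρ₀ ⊗ F` on `Fⁿ`.  Then there are homomorphisms
`A : G → GL_m(O)`, `D : G → GL_p(O)` with `0 < m`, `0 < p`, `m + p = n` and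
`det(X - ρ₀(g)) = det(X - A(g)) · det(X - D(g))` in `O[X]` for all `g`.  Proof: the saturated
sub-lattice `Λ_W = Oⁿ ∩ W` is stable; `Oⁿ/Λ_W ↪ Fⁿ/W` is finitely generated and torsion-free,
hence free (`free_of_torsion_eq_bot_valuationSubring`), so `Oⁿ = Λ_W ⊕ C` with `Λ_W`, `C` free
(`Λ_W ≅ Oⁿ/C` is finitely generated and torsion-free), and `exists_blocks_of_isCompl_of_basis`
applies; `Λ_W ≠ 0` by clearing denominators in a non-zero vector of `W`, and `C ≠ 0` since
otherwise `W` contains the standard basis. [cite: SerreAbelianLadic1968, Ch. I §1.1] -/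
theorem exists_blocks_of_subrepresentation_valuationSubring (ρ₀ : G →* GL (Fin n) O)
    (W : Subrepresentation (glRepresentation ((Matrix.GeneralLinearGroup.map O.subtype).comp ρ₀)))
    (hW0 : W ≠ ⊥) (hW1 : W ≠ ⊤) :
    ∃ m p : ℕ, 0 < m ∧ 0 < p ∧ m + p = n ∧
      ∃ (A : G →* GL (Fin m) O) (D : G →* GL (Fin p) O), ∀ g,
        ((ρ₀ g : GL (Fin n) O) : Matrix (Fin n) (Fin n) O).charpoly =
          ((A g : GL (Fin m) O) : Matrix (Fin m) (Fin m) O).charpoly *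
            ((D g : GL (Fin p) O) : Matrix (Fin p) (Fin p) O).charpoly := by
  classical
  -- the inclusion `Oⁿ ↪ Fⁿ` and its compatibility with the action
  let ιF : (Fin n → O) →ₗ[O] (Fin n → F) := (Algebra.linearMap O F).compLeft (Fin n)
  have hιF : ∀ v, ιF v = fun i ↦ ((v i : O) : F) := fun v ↦ rfl
  have hιF_inj : Function.Injective ιF := fun v w h ↦
    funext fun i ↦ Subtype.ext (congr_fun h i)
  have hact : ∀ (g : G) (v : Fin n → O),
      ιF (((ρ₀ g : GL (Fin n) O) : Matrix (Fin n) (Fin n) O) *ᵥ v) =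
        ((((Matrix.GeneralLinearGroup.map O.subtype).comp ρ₀ g : GL (Fin n) F)) :
          Matrix (Fin n) (Fin n) F) *ᵥ ιF v := by
    intro g v
    funext i
    exact RingHom.map_mulVec O.subtype _ v i
  -- the saturated sub-lattice `Λ_W = Oⁿ ∩ W`
  let ΛW : Submodule O (Fin n → O) := (W.toSubmodule.restrictScalars O).comap ιF
  have hΛW : ∀ v, v ∈ ΛW ↔ ιF v ∈ W.toSubmodule := fun v ↦ Iff.rfl
  have hstab : ∀ g, ∀ v ∈ ΛW, ((ρ₀ g : GL (Fin n) O) : Matrix (Fin n) (Fin n) O) *ᵥ v ∈ ΛW := by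
    intro g v hv
    rw [hΛW, hact]
    exact W.apply_mem_toSubmodule g hv
  -- `Oⁿ / Λ_W` is torsion-free (it embeds in `Fⁿ / W`), hence free
  have htors : Submodule.torsion O ((Fin n → O) ⧸ ΛW) = ⊥ := by
    rw [Submodule.eq_bot_iff]
    intro x hx
    obtain ⟨⟨a, ha⟩, hax⟩ := (Submodule.mem_torsion_iff x).mp hx
    induction x using Submodule.Quotient.induction_on with
    | _ v =>
      rw [Submodule.Quotient.mk_eq_zero, hΛW]
      have hav : a • v ∈ ΛW := by
        rw [← Submodule.Quotient.mk_eq_zero, Submodule.Quotient.mk_smul]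
        exact hax
      rw [hΛW, map_smul] at hav
      have ha0 : ((a : O) : F) ≠ 0 := by
        have := nonZeroDivisors.ne_zero ha
        exact_mod_cast this
      have : (a : O) • ιF v = ((a : O) : F) • ιF v := rfl
      rw [this] at hav
      exact (Submodule.smul_mem_iff _ ha0).mp hav
  haveI hQfree : Module.Free O ((Fin n → O) ⧸ ΛW) := free_of_torsion_eq_bot_valuationSubring _ htors
  -- a section of `Oⁿ → Oⁿ/Λ_W` and the complement `C`
  obtain ⟨s, hs⟩ := Module.projective_lifting_property ΛW.mkQ (LinearMap.id)
    (Submodule.mkQ_surjective ΛW)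
  have hs' : ∀ q, ΛW.mkQ (s q) = q := fun q ↦ LinearMap.congr_fun hs q
  have hs_inj : Function.Injective s := fun q q' h ↦ by rw [← hs' q, ← hs' q', h]
  let C : Submodule O (Fin n → O) := LinearMap.range s
  have hproj : LinearMap.IsProj C (s ∘ₗ ΛW.mkQ) :=
    ⟨fun x ↦ LinearMap.mem_range_self s _, fun x hx ↦ by
      obtain ⟨q, rfl⟩ := hx
      simp only [LinearMap.coe_comp, Function.comp_apply, hs']⟩
  have hker : LinearMap.ker (s ∘ₗ ΛW.mkQ) = ΛW := by
    rw [LinearMap.ker_comp_of_ker_eq_bot _ (LinearMap.ker_eq_bot.mpr hs_inj), Submodule.ker_mkQ]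
  have hc : IsCompl ΛW C := by
    have := hproj.isCompl
    rw [hker] at this
    exact this.symm
  -- both summands are free of finite rank
  haveI : Module.Finite O C := inferInstance
  haveI : Module.Free O C := Module.Free.of_equiv (LinearEquiv.ofInjective s hs_inj)
  haveI : Module.Finite O ΛW := Module.Finite.equiv (Submodule.quotientEquivOfIsCompl C ΛW hc.symm)
  have htorsW : Submodule.torsion O ΛW = ⊥ :=
    Submodule.isTorsionFree_iff_torsion_eq_bot.mp inferInstance
  haveI : Module.Free O ΛW := free_of_torsion_eq_bot_valuationSubring _ htorsW
  obtain ⟨m, bW⟩ : Σ m : ℕ, Basis (Fin m) O ΛW :=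
    ⟨_, (Module.Free.chooseBasis O ΛW).reindex (Fintype.equivFin _)⟩
  obtain ⟨p, bC⟩ : Σ p : ℕ, Basis (Fin p) O C :=
    ⟨_, (Module.Free.chooseBasis O C).reindex (Fintype.equivFin _)⟩
  obtain ⟨hmp, A, D, hAD⟩ := exists_blocks_of_isCompl_of_basis ρ₀ ΛW C hc bW bC hstab
  -- `Λ_W ≠ 0`: clear denominators in a non-zero vector of `W`
  have hbot : (⊥ : Subrepresentation
      (glRepresentation ((Matrix.GeneralLinearGroup.map O.subtype).comp ρ₀))).toSubmodule = ⊥ := rfl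
  have htop : (⊤ : Subrepresentation
      (glRepresentation ((Matrix.GeneralLinearGroup.map O.subtype).comp ρ₀))).toSubmodule = ⊤ := rfl
  have hm : 0 < m := by
    have hWS0 : W.toSubmodule ≠ ⊥ := fun h ↦
      hW0 (Subrepresentation.toSubmodule_injective (h.trans hbot.symm))
    obtain ⟨w, hwW, hw0⟩ := Submodule.exists_mem_ne_zero_of_ne_bot hWS0
    obtain ⟨⟨c, hc0⟩, hcw⟩ :=
      IsLocalization.exist_integer_multiples_of_finite (nonZeroDivisors O) (fun i ↦ w i)
    choose v hv using hcw
    have hιv : ιF v = ((c : O) : F) • w := by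
      rw [hιF]
      funext i
      rw [Pi.smul_apply]
      exact (hv i).trans rfl
    have hvW : v ∈ ΛW := by
      rw [hΛW, hιv]
      exact W.toSubmodule.smul_mem _ hwW
    have hv0 : v ≠ 0 := by
      intro h
      have hc0' : ((c : O) : F) ≠ 0 := by
        have := nonZeroDivisors.ne_zero hc0
        exact_mod_cast this
      apply hw0
      have : ((c : O) : F) • w = 0 := by rw [← hιv, h, map_zero]
      exact (smul_eq_zero.mp this).resolve_left hc0'
    refine Nat.pos_of_ne_zero fun hm0 ↦ hv0 ?_
    subst hm0
    haveI : Subsingleton ΛW := bW.repr.toEquiv.subsingleton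
    have : (⟨v, hvW⟩ : ΛW) = 0 := Subsingleton.elim _ _
    exact congrArg Subtype.val this
  -- `C ≠ 0`: otherwise `W` contains the standard basis
  have hp : 0 < p := by
    refine Nat.pos_of_ne_zero fun hp0 ↦ hW1 ?_
    subst hp0
    haveI : Subsingleton C := bC.repr.toEquiv.subsingleton
    have hC : C = ⊥ := by
      rw [Submodule.eq_bot_iff]
      intro x hx
      exact congrArg Subtype.val (Subsingleton.elim (⟨x, hx⟩ : C) 0)
    have hΛtop : ΛW = ⊤ := by
      have := hc.sup_eq_top
      rwa [hC, sup_bot_eq] at this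
    refine Subrepresentation.toSubmodule_injective (htop ▸ ?_)
    rw [eq_top_iff, ← (Pi.basisFun F (Fin n)).span_eq, Submodule.span_le]
    rintro _ ⟨j, rfl⟩
    rw [SetLike.mem_coe, Pi.basisFun_apply]
    have hj : (Pi.single j 1 : Fin n → O) ∈ ΛW := by rw [hΛtop]; trivial
    rw [hΛW] at hj
    convert hj using 1
    rw [hιF]
    ext i
    by_cases h : i = j
    · subst h; simp
    · simp [Pi.single_eq_of_ne h]
  exact ⟨m, p, hm, hp, hmp, A, D, hAD⟩

end Saturation

end Literature.NumberTheory.GaloisRepresentations
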